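import Literature.MathematicalPhysics.QuantumFieldTheory.Balaban1983to89.T4ForestGaugeSameRootBound
import Literature.MathematicalPhysics.QuantumFieldTheory.Balaban1983to89.BlockAveragingTowerStraightTransportLocal

/-!
# `Balaban1983to89.T4ForestGaugeCorridorBound` — [Balaban1985Variational] (16)–(18) p. 280, the CORRIDOR half of the axial-gauge smallness letter: in the forest gauge
# `σ(x) = 𝒰_U(path x)` a fine bond `b = ⟨s, s + e_μ⟩` whose ends hang from TWO roots `r₁`, `r₂` reads the OPEN transport `𝒰_U(r₁ ⇝ s → s + e_μ ⇝ r₂)`, which is within a located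
# Stokes bound ([Balaban1985Averaging] (19)–(20)) of ANY fine transporter `𝒰_U(walk r₁ Ω)` from `r₁` to `r₂` — and for the two rooted centres `r₁ = ι_j c₋`, `r₂ = ι_j c₊` of a member
# bond `c` the straight transporter is within `θ_j` of the `j`-fold (0.4)-average `M^j(U)(c)` (dag-n12-w2's `BlockAveragingTowerStraightTransportLocal`, BY NAME) — so
# `|(U^σ)(b) − 1| ≤ (Stokes) + θ_j + |M^j(U)(c) − 1|`

statement-level skeleton of published theorems with citation tags; proofs where landed; nothing here is a claim about the Yang–Mills mass gap

WHY (cell `pub-ymgap`, width seat `pub-ymgap-dag-n12-w6` g1; node N12 = [B15]; brick C′ of the seat's `Q2-DESIGN.md` §8; lane word dag-n12-c g18 «take both (q2-a)(q2-b)»; the transport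
comparison is dag-n12-w2 g4's file, imported — this seat's standalone §2 was withdrawn unfiled in its favour, bus 2026-08-28 10:55Z).  The interior letter `hL` of
`B15Prop1MinimiserTowerAxialGauge` §6 bounds `dist1 ((U^σ) b)` for the input bonds `b ∈ feeds j c` of the member bonds `c`.  The SAME-ROOT bonds are `T4ForestGaugeSameRootBound`
(p625609).  THIS FILE does the bonds joining the towers of two different roots: with `path s = walk r₁ w₁`, `path (s+e_μ) = walk r₂ w₂` and any fine word `Ω` from `r₁` to `r₂`,
`(U^σ)(b) = 𝒰(walk r₁ w₁)·U(b)·𝒰(walk r₂ w₂)⁻¹ = Λ · H`, `H = 𝒰_U(walk r₁ Ω)`, `Λ` the holonomy of the CLOSED word `w₁ · (+e_μ) · (Ω · w₂)ᵒᵖ` — bounded by p625609's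
`dist1_holAt_bond_le_of_sameRoot_of_length_lt` (the tree's located Stokes bound `LatticeWordStokesLocal`); if `H` is within `e` of a group element `g` then
`dist1 ((U^σ) b) ≤ Stokes + e + dist1 g`.  For a member bond `c` of level `j`: `Ω` = the straight segment of `L^j` letters, `g = M^j(U)(c)`, `e = θ_j` by
`BlockAveragingTowerStraightTransportLocal.dist1_iter_blockAvg_mul_inv_straight_le_local` (correction factors of [Balaban1987RG1] (0.4) bounded ON THE SEGMENT only); for a CHAIN of
member bonds of mixed levels and orientations joining `r₁` to `r₂` (the boundary blocks of `Ω_j` carry lower-level roots — `Q2-DESIGN.md` §8): `Ω` = the concatenated segments, `g` = the ordered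
product of the `M(c_l)^{±1}`, `e = Σ θ` by the CHAINING lemma and the backward-segment reading below.  Any `GaugeGroup`, any small-loop average `ℰ`; the forest, the plaquette smallness of the
minimiser on the towers ([III] (2.14)) and the correction-factor bounds up the tower ([Balaban1985Averaging] Prop. 1–2; dag-n12-w2's `…_of_plaqSmall_local` editions) stay hypotheses.

CONTENTS (theorems only; no `def`, no `instance`, no `sorry`).
* §1 `dist1_holAt_append_mul_mul_inv_le` (CHAINING: transporter errors along concatenated words add up), `embIter_tgt_eq_walkEnd_replicate` (`ι_j c₊ = ι_j c₋ + L^j e_{dir c}` as a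
  `walkEnd`, from dag-n12-w2's `embIter_iterate_shift`), ★★ `dist1_segRev_mul_iter_blockAvg_le` (the BACKWARD segment `ι_j c₊ → ι_j c₋` versus `M^j(U)(c)⁻¹`, same cost `θ_j`).
* §2 ★★★ `dist1_gaugeAct_holAtGauge_le_of_transporter` — THE MASTER BOUND for a bond joining the towers of two roots `r₁`, `r₂` given ANY fine word `Ω` from `r₁` to `r₂` whose transporter
  is within `e` of `g`: `dist1 ((U^σ)⟨s, μ⟩) ≤ ((|w₁|+1+|Ω|+|w₂|)²/4)·δ + e + dist1 g`; ★★★ `dist1_gaugeAct_holAtGauge_le_of_corridor` — the member-bond instance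
  (`Ω` = the straight segment, `g = M^j(U)(c)`, `e = θ_j`): `dist1 ((U^σ)⟨s, μ⟩) ≤ ((|w₁|+1+L^j+|w₂|)²/4)·δ + θ_j + dist1 (M^j(U)(c))`.
* §3 (v1.1) ★★ `dist1_holAt_chain_mul_prod_inv_le` (CHAINS of links `(ω_l, g_l, e_l)`: `dist1 (𝒰(ω_1⋯ω_m)·(g_1⋯g_m)⁻¹) ≤ Σ e_l`), `dist1_prod_le_sum`, `length_flatten_map_fst`.

HONEST FRAMING: [folklore] lattice/group bookkeeping + landed theorems by name; no estimate of Bałaban's asserted; count-neutral; N12 NOT discharged; nothing continuum ∕ OS ∕ mass-gap ∕ Clay.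
-/

noncomputable section

namespace Literature.MathematicalPhysics.QuantumFieldTheory.Balaban1983to89.T4ForestGaugeCorridorBound

open T4Continuum T4ReflectionCone BlockAveraging
open B15DeterminingSets (embIter)
open T4ForestGaugeSameRootBound (dist1_holAt_bond_le_of_sameRoot_of_length_lt)
open BlockAveragingTowerStraightTransportLocal (dist1_iter_blockAvg_mul_inv_straight_le_local dist1_straight_mul_inv_iter_le_local embIter_iterate_shift
  walkEnd_replicate_true_eq_iterate)

variable {P : Params} {j : ℕ} {G : Type*} [GaugeGroup G]

/-! ## §1 Chaining, the second centre, the backward segment -/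

/-- **CHAINING**: transporter errors along concatenated words add up — `dist1 (𝒰(ω₁ω₂)·(g₁g₂)⁻¹) ≤ dist1 (𝒰(ω₁)·g₁⁻¹) + dist1 (𝒰(ω₂)·g₂⁻¹)` (unitary invariance); chains of member bonds of any
levels and orientations between two roots compose into one transporter estimate for §2. [cite: Balaban1985Averaging, (19)-(20) p.21] -/
theorem dist1_holAt_append_mul_mul_inv_le (U : GaugeField P j G) (x : Site P j) (ω₁ ω₂ : List (Letter P.d)) (g₁ g₂ : G) :
    dist1 (holAt U (walk x (ω₁ ++ ω₂)) * (g₁ * g₂)⁻¹) ≤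
      dist1 (holAt U (walk x ω₁) * g₁⁻¹) + dist1 (holAt U (walk (walkEnd x ω₁) ω₂) * g₂⁻¹) := by
  rw [walk_append, holAt_append]
  set H₁ := holAt U (walk x ω₁)
  set H₂ := holAt U (walk (walkEnd x ω₁) ω₂)
  have hre : H₁ * H₂ * (g₁ * g₂)⁻¹ = H₁ * (H₂ * g₂⁻¹) * H₁⁻¹ * (H₁ * g₁⁻¹) := by
    simp only [mul_inv_rev, mul_assoc, inv_mul_cancel_left]
  rw [hre]
  calc dist1 (H₁ * (H₂ * g₂⁻¹) * H₁⁻¹ * (H₁ * g₁⁻¹))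
      ≤ dist1 (H₁ * (H₂ * g₂⁻¹) * H₁⁻¹) + dist1 (H₁ * g₁⁻¹) := GaugeGroup.dist1_mul_le _ _
    _ = dist1 (H₂ * g₂⁻¹) + dist1 (H₁ * g₁⁻¹) := by rw [GaugeGroup.dist1_conj]
    _ = _ := add_comm _ _

/-- `ι_j c₊` is the end of the straight fine walk of `L^j` steps `+e_{dir c}` from `ι_j c₋` (dag-n12-w2's `embIter_iterate_shift` at `t = 1`, read as a `walkEnd`).
[cite: Balaban1987RG1, (0.1) p.251 (bookkeeping)] -/
theorem embIter_tgt_eq_walkEnd_replicate (j : ℕ) (c : PBond P j) :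
    embIter j c.tgt = walkEnd (embIter j c.src) (List.replicate (P.L ^ j) (c.dir, true)) := by
  have h := embIter_iterate_shift c.dir j 1 c.src
  rw [Nat.one_mul, Function.iterate_one] at h
  rw [walkEnd_replicate_true_eq_iterate]
  exact h

/-- ★★ **THE BACKWARD SEGMENT**: the straight fine walk from `ι_j c₊` back to `ι_j c₋` (`L^j` letters `−e_{dir c}`) versus `M^j(U)(c)⁻¹`, at the same cost `θ_j` as dag-n12-w2's forward
comparison (`𝒰(−Γ) = 𝒰(Γ)⁻¹`, `|g⁻¹h − 1| = |hg⁻¹ − 1|`) — for chains traversing a member bond against its orientation. [cite: Balaban1987RG1, (0.4) and (0.11) p.253; Balaban1985Averaging, (19)-(20) p.21] -/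
theorem dist1_segRev_mul_iter_blockAvg_le (ℰ : LoopAverage G) (U : GaugeField P 0 G) (κ θ : ℕ → ℝ) (hθ0 : 0 ≤ θ 0)
    (hθ : ∀ i, κ i + P.L * θ i ≤ θ (i + 1)) (j : ℕ) (c : PBond P j)
    (hκ : ∀ i < j, ∀ c' : PBond P (i + 1), c'.dir = c.dir →
      (∃ s < P.L ^ j, embIter (i + 1) c'.src = (fun z : Site P 0 => z.shift c.dir)^[s] (embIter j c.src)) →
      dist1 (corr ℰ (Averaging.iter (fun i => blockAvg (P := P) (j := i) ℰ) i U) c') ≤ κ i) :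
    dist1 (holAt U (walk (embIter j c.tgt) (wordRev (List.replicate (P.L ^ j) (c.dir, true)))) *
      ((Averaging.iter (fun i => blockAvg (P := P) (j := i) ℰ) j U c)⁻¹)⁻¹) ≤ θ j := by
  rw [embIter_tgt_eq_walkEnd_replicate, holAt_walk_wordRev, inv_inv,
    ← GaugeGroup.dist1_conj _ (holAt U (walk (embIter j c.src) (List.replicate (P.L ^ j) (c.dir, true)))), ← mul_assoc, mul_inv_cancel, one_mul]
  exact dist1_iter_blockAvg_mul_inv_straight_le_local ℰ U κ θ hθ0 hθ j c hκ

/-! ## §2 The corridor bound -/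

/-- ★★★ **THE MASTER BOUND FOR A BOND BETWEEN TWO TOWERS** ([Balaban1985Variational] (16)–(18) in the forest gauge).  Data: a fine configuration `U`, a forest `path`, two roots `r₁`, `r₂` and a fine
word `Ω` from `r₁` to `r₂` whose transporter `𝒰_U(walk r₁ Ω)` is within `e` of a group element `g` (for a member bond: the straight segment and `g = M^j(U)(c)`; for a chain of member bonds: the
concatenated segments and the ordered product of the averages, `dist1_holAt_append_mul_mul_inv_le`); a fine bond `⟨s, s + e_μ⟩` with `path s = walk r₁ w₁`, `path (s + e_μ) = walk r₂ w₂`;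
no wrapping (`|w₁| + 1 + |Ω| + |w₂| <` sites per direction); every plaquette based in the COUNT BOX at `r₁` of the closed word `w₁ · (+e_μ) · (Ω · w₂)ᵒᵖ` within `δ` of `1`.  THEN at
`σ x := 𝒰_U(path x)`: `dist1 ((U^σ)⟨s, μ⟩) ≤ ((|w₁| + 1 + (|Ω| + |w₂|))²/4)·δ + e + dist1 g` — `(U^σ)(b) = Λ · (H g⁻¹) · g` with `Λ` the closed-word holonomy (p625609) and `H = 𝒰_U(walk r₁ Ω)`.
[cite: Balaban1985Variational, (16)-(18) p.280; Balaban1985RegularSpaces, (1.19) p.79; Balaban1985Averaging, (19)-(20) p.21] -/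
theorem dist1_gaugeAct_holAtGauge_le_of_transporter (U : GaugeField P 0 G) (path : Site P 0 → List (LStep P 0))
    (r₁ r₂ : Site P 0) (Ω : List (Letter P.d)) (hΩ : walkEnd r₁ Ω = r₂) (g : G) {e : ℝ} (hH : dist1 (holAt U (walk r₁ Ω) * g⁻¹) ≤ e)
    (s : Site P 0) (μ : Fin P.d) (w₁ w₂ : List (Letter P.d))
    (hps : path s = walk r₁ w₁) (hpt : path (s.shift μ) = walk r₂ w₂) (hs : walkEnd r₁ w₁ = s) (ht : walkEnd r₂ w₂ = s.shift μ)
    (hlen : w₁.length + 1 + (Ω.length + w₂.length) < P.sitesPerDir 0) {δ : ℝ} (hδ : 0 ≤ δ)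
    (hloc : ∀ u : List (Letter P.d), (∀ l, u.count l ≤ (w₁ ++ (μ, true) :: wordRev (Ω ++ w₂)).count l) →
      ∀ (a b : Fin P.d) (hab : a < b), dist1 (GaugeField.plaqHol U ⟨walkEnd r₁ u, a, b, hab⟩) < δ) :
    dist1 (GaugeField.gaugeAct (fun x => holAt U (path x)) U ⟨s, μ⟩) ≤
      (((w₁.length + 1 + (Ω.length + w₂.length) : ℕ) : ℝ) ^ 2 / 4) * δ + e + dist1 g := by
  set Aw := holAt U (walk r₁ w₁) with hAw
  set Bw := holAt U (walk r₂ w₂) with hBw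
  set H := holAt U (walk r₁ Ω) with hH'
  -- the closed-word factor `Λ = Aw · U b · (H · Bw)⁻¹`
  have ht' : walkEnd r₁ (Ω ++ w₂) = s.shift μ := by rw [walkEnd_append, hΩ, ht]
  have hlen' : w₁.length + 1 + (Ω ++ w₂).length < P.sitesPerDir 0 := by rw [List.length_append]; exact hlen
  have hΛ := dist1_holAt_bond_le_of_sameRoot_of_length_lt U r₁ s μ w₁ (Ω ++ w₂) hs ht' hlen' hδ hloc
  rw [List.length_append] at hΛ
  have hsplit : holAt U (walk r₁ (Ω ++ w₂)) = H * Bw := by rw [walk_append, holAt_append, hΩ]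
  rw [hsplit] at hΛ
  have hHg : dist1 (H * g⁻¹) ≤ e := hH
  -- assemble `(U^σ)(b) = Λ · (H · g⁻¹) · g`
  show dist1 (holAt U (path s) * U ⟨s, μ⟩ * (holAt U (path (PBond.tgt ⟨s, μ⟩)))⁻¹) ≤ _
  rw [show (PBond.tgt ⟨s, μ⟩ : Site P 0) = s.shift μ from rfl, hps, hpt]
  have hid : holAt U (walk r₁ w₁) * U ⟨s, μ⟩ * (holAt U (walk r₂ w₂))⁻¹ =
      Aw * U ⟨s, μ⟩ * (H * Bw)⁻¹ * (H * g⁻¹) * g := by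
    simp only [← hAw, ← hBw, mul_inv_rev, mul_assoc, inv_mul_cancel_left, inv_mul_cancel, mul_one]
  rw [hid]
  calc dist1 (Aw * U ⟨s, μ⟩ * (H * Bw)⁻¹ * (H * g⁻¹) * g)
      ≤ dist1 (Aw * U ⟨s, μ⟩ * (H * Bw)⁻¹ * (H * g⁻¹)) + dist1 g := GaugeGroup.dist1_mul_le _ _
    _ ≤ dist1 (Aw * U ⟨s, μ⟩ * (H * Bw)⁻¹) + dist1 (H * g⁻¹) + dist1 g := by
        have := GaugeGroup.dist1_mul_le (Aw * U ⟨s, μ⟩ * (H * Bw)⁻¹) (H * g⁻¹); linarith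
    _ ≤ _ := by linarith [hΛ, hHg]

/-- ★★★ **THE CORRIDOR BOUND FOR A MEMBER BOND** ([Balaban1985Variational] (16)–(18) in the forest gauge, the bonds between the two towers of a member bond).  Data: a fine configuration `U`, a
forest `path`, a level-`j` bond `c` with rooted centres `r₁ = ι_j c₋`, `r₂ = ι_j c₊`; a fine bond `⟨s, s + e_μ⟩` with `path s = walk r₁ w₁`, `path (s + e_μ) = walk r₂ w₂` (ends as stated),
`|w₁| + 1 + L^j + |w₂| <` sites per direction (no wrapping); every plaquette based in the COUNT BOX at `r₁` of the closed word `w₁ · (+e_μ) · (seg · w₂)ᵒᵖ` (`seg` = `L^j` letters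
`+e_{dir c}`) within `δ` of `1`; the correction factors of the (0.4)-averages met on the segment `[r₁, r₂]` within `κ_i` of `1` and `θ` a super-solution of `κ_i + L·θ_i ≤ θ_{i+1}`, `0 ≤ θ₀`
(dag-n12-w2's currency VERBATIM).  THEN, at the gauge `σ x := 𝒰_U(path x)`, `dist1 ((U^σ)⟨s, μ⟩) ≤ ((|w₁| + 1 + (L^j + |w₂|))²/4)·δ + θ_j + dist1 (M^j(U)(c))` — the master bound with
`Ω = seg`, `g = M^j(U)(c)`, `e = θ_j` (`BlockAveragingTowerStraightTransportLocal.dist1_straight_mul_inv_iter_le_local`).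
[cite: Balaban1985Variational, (16)-(18) p.280; Balaban1985RegularSpaces, (1.19) p.79; Balaban1987RG1, (0.4) p.253] -/
theorem dist1_gaugeAct_holAtGauge_le_of_corridor (ℰ : LoopAverage G) (U : GaugeField P 0 G) (path : Site P 0 → List (LStep P 0))
    (κ θ : ℕ → ℝ) (hθ0 : 0 ≤ θ 0) (hθ : ∀ i, κ i + P.L * θ i ≤ θ (i + 1))
    {j : ℕ} (c : PBond P j) (s : Site P 0) (μ : Fin P.d) (w₁ w₂ : List (Letter P.d))
    (hps : path s = walk (embIter j c.src) w₁) (hpt : path (s.shift μ) = walk (embIter j c.tgt) w₂)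
    (hs : walkEnd (embIter j c.src) w₁ = s) (ht : walkEnd (embIter j c.tgt) w₂ = s.shift μ)
    (hlen : w₁.length + 1 + (P.L ^ j + w₂.length) < P.sitesPerDir 0)
    {δ : ℝ} (hδ : 0 ≤ δ)
    (hloc : ∀ u : List (Letter P.d),
      (∀ l, u.count l ≤ (w₁ ++ (μ, true) :: wordRev (List.replicate (P.L ^ j) (c.dir, true) ++ w₂)).count l) →
      ∀ (a b : Fin P.d) (hab : a < b), dist1 (GaugeField.plaqHol U ⟨walkEnd (embIter j c.src) u, a, b, hab⟩) < δ)
    (hκ : ∀ i < j, ∀ c' : PBond P (i + 1), c'.dir = c.dir →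
      (∃ t < P.L ^ j, embIter (i + 1) c'.src = (fun z : Site P 0 => z.shift c.dir)^[t] (embIter j c.src)) →
      dist1 (corr ℰ (Averaging.iter (fun i => blockAvg (P := P) (j := i) ℰ) i U) c') ≤ κ i) :
    dist1 (GaugeField.gaugeAct (fun x => holAt U (path x)) U ⟨s, μ⟩) ≤
      (((w₁.length + 1 + (P.L ^ j + w₂.length) : ℕ) : ℝ) ^ 2 / 4) * δ + θ j +
        dist1 (Averaging.iter (fun i => blockAvg (P := P) (j := i) ℰ) j U c) := by
  have h := dist1_gaugeAct_holAtGauge_le_of_transporter U path (embIter j c.src) (embIter j c.tgt)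
    (List.replicate (P.L ^ j) (c.dir, true)) (embIter_tgt_eq_walkEnd_replicate j c).symm _
    (dist1_straight_mul_inv_iter_le_local ℰ U κ θ hθ0 hθ j c hκ)
    s μ w₁ w₂ hps hpt hs ht (by rw [List.length_replicate]; exact hlen) hδ hloc
  rw [List.length_replicate] at h
  exact h

/-! ## §3 (v1.1) Chains of segments: the transporter letter for a concatenation of member-bond segments -/

/-- **CHAINS**: for a list of links `(ω_l, g_l, e_l)` — fine words `ω_l` read consecutively from `x`, group elements `g_l`, error budgets `e_l` — if every link's transporter from ITS OWN start point
`walkEnd x (ω_1 ⋯ ω_{l−1})` is within `e_l` of `g_l`, then the transporter of the concatenated word is within `Σ e_l` of the ordered product `Π g_l` (`dist1_holAt_append_mul_mul_inv_le` iterated;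
links are addressed by the decomposition `links = pre ++ link :: post`, no indices).  With dag-n12-w2's forward∕backward segment bounds per member bond this is the letter `hH` of
`dist1_gaugeAct_holAtGauge_le_of_transporter` for a chain of member bonds of mixed levels and orientations. [cite: Balaban1985Averaging, (19)-(20) p.21; Balaban1985Variational, (16)-(18) p.280] -/
theorem dist1_holAt_chain_mul_prod_inv_le (U : GaugeField P j G) :
    ∀ (links : List (List (Letter P.d) × G × ℝ)) (x : Site P j),
      (∀ (pre post : List (List (Letter P.d) × G × ℝ)) (link : List (Letter P.d) × G × ℝ), links = pre ++ link :: post →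
        dist1 (holAt U (walk (walkEnd x (pre.map Prod.fst).flatten) link.1) * (link.2.1)⁻¹) ≤ link.2.2) →
      dist1 (holAt U (walk x (links.map Prod.fst).flatten) * ((links.map fun l => l.2.1).prod)⁻¹) ≤ (links.map fun l => l.2.2).sum
  | [], x, _ => by simp [walk, holAt_nil, GaugeGroup.dist1_one]
  | link :: links, x, h => by
      have h0 : dist1 (holAt U (walk x link.1) * (link.2.1)⁻¹) ≤ link.2.2 := h [] links link rfl
      have ih := dist1_holAt_chain_mul_prod_inv_le U links (walkEnd x link.1) (fun pre post link' hsplit => by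
        have := h (link :: pre) post link' (by rw [hsplit]; rfl)
        simpa only [List.map_cons, List.flatten_cons, walkEnd_append] using this)
      simp only [List.map_cons, List.flatten_cons, List.prod_cons, List.sum_cons]
      exact (dist1_holAt_append_mul_mul_inv_le U x link.1 _ link.2.1 _).trans (add_le_add h0 ih)

/-- `|Π g_l − 1| ≤ Σ |g_l − 1|` — the `dist1 g` term of the master bound for a chain: the ordered product of the member averages (or their inverses, `dist1_inv`) is as close to `1` as the
sum of their distances. [cite: Balaban1985Averaging, (19)-(20) p.21 (bookkeeping)] -/
theorem dist1_prod_le_sum {G : Type*} [GaugeGroup G] : ∀ gs : List G, dist1 gs.prod ≤ (gs.map dist1).sum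
  | [] => by simp [GaugeGroup.dist1_one]
  | g :: gs => by
      rw [List.prod_cons, List.map_cons, List.sum_cons]
      exact (GaugeGroup.dist1_mul_le _ _).trans (add_le_add le_rfl (dist1_prod_le_sum gs))

/-- The length of a concatenation of links is the sum of the link lengths (for the no-wrapping and count-box budgets of the master bound). [cite: Balaban1985Averaging, (5)-(9) pp.18-19 (bookkeeping)] -/
theorem length_flatten_map_fst {α β : Type*} (links : List (List α × β)) :
    ((links.map Prod.fst).flatten).length = (links.map fun l => l.1.length).sum := by
  induction links with
  | nil => simp
  | cons l ls ih => simp [List.flatten_cons, ih]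

end Literature.MathematicalPhysics.QuantumFieldTheory.Balaban1983to89.T4ForestGaugeCorridorBound

end
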